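import Literature.NumberTheory.Sieve.MatomakiRadziwillLemma4Lipschitz
import HarnessLib

/-!
# Matomäki–Radziwiłł 2016, Lemma 4: the long-sum Lipschitz bound with Theorem 4 for central maximisers

Topic `NumberTheory/Sieve`.  `MatomakiRadziwillLemma4Lipschitz.lean` proves
`MatomakiRadziwillL4A.lipschitz_of_GS : theorem1 → lemma23 → theorem3 → theorem4_sqrtRange → corollary3 →
lemma71 → MatomakiRadziwill2016_lemma4_lipschitz` (facts of Granville–Soundararajan 2003,
`Literature/NumberTheory/LFunctions/GranvilleSoundararajan2003.lean`).  Meanwhile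
`GranvilleSoundararajan2003_theorem4_sqrtRange` was found to be FALSE for maximisers `y₀` at the edge of the
window `|y| ≤ 2 log x` (witness `f(n) = n^{iu}`, `u = -2 log x - (log x)^{-3/4}`, recorded in its
docstring), so that chain can never be closed.  The proof of `lipschitz_of_GS`, however, invokes Theorem 4
only in its last case, where the maximiser satisfies `|y₀| < 1/100`; what §6 of GS03 proves (its display
(6.1) needs `|y| + |y₀| ≤ 2 log x`) is Theorem 4 for CENTRAL maximisers `|y₀| ≤ log x`.  This file
re-runs the same proof with the hypothesis weakened accordingly:

* `MatomakiRadziwillL4A.lipschitz_of_GS_central :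
    theorem1 → lemma23 → theorem3 → (Theorem 4 for x ≥ x₀, maximisers with |y₀| ≤ 1, 1 ≤ w ≤ √x) →
    corollary3 → lemma71 → MatomakiRadziwill2016_lemma4_lipschitz`
  — the fourth hypothesis is DISPLAYED in the statement (no new named fact is introduced; it is weaker
  than, and meant to be fed by, the corrected Theorem 4 for central maximisers once that lands); the proof
  text is that of `lipschitz_of_GS`, verbatim but for the one invocation of Theorem 4, which now also passes
  `|y₀| ≤ 1`, available from `|y₀| < 1/100`.

* `MatomakiRadziwillL4A.lipschitz_of_GS_of_theorem4_central`, `MatomakiRadziwill2016_lemma4_of_GS_central` —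
  the same chain fed by the corrected named fact `GranvilleSoundararajan2003_theorem4_central` of
  `GranvilleSoundararajan2003.lean` (Theorem 4 for `x ≥ x₀`, `1 ≤ w ≤ √x` and central maximisers
  `|y₀| ≤ log x`, the statement §6 of GS03 proves; landed 2026-08-15), which implies the displayed
  hypothesis with `x₀ ↦ max x₀ e` (`|y₀| ≤ 1 ≤ log x`):
    `theorem1 → lemma23 → theorem3 → theorem4_central → corollary3 → lemma71 → MatomakiRadziwill2016_lemma4_lipschitz`
  and `… → MatomakiRadziwill2016_lemma4`.  These are the paper-facing entry points to use in place of
  `lipschitz_of_GS` / `MatomakiRadziwill2016_lemma4_of_GS` (whose fourth hypothesis is the refuted rendering).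

Of the six inputs, Theorem 1, Lemma 2.3 and Lemma 7.1 are discharged in the tree
(`GranvilleSoundararajan2003_theorem1_holds`, `…_lemma23_holds`, `…_lemma71_holds`); Theorem 3 follows
from them (`GranvilleSoundararajanTheorem3Proofs.lean`); the corrected Theorem 4 and Corollary 3 are in
progress.  See `MatomakiRadziwillLemma4Lipschitz.lean` for the mathematical commentary (Steps 1–3, cases
3a–3c and the sign trick), which applies word for word.

## References
* K. Matomäki, M. Radziwiłł, *Multiplicative functions in short intervals*, Ann. of Math. (2) 183
  (2016), §3, Lemma 4 and its proof (arXiv:1501.04585, pp. 9–10). [MatomakiRadziwillAnnals2016]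
* A. Granville, K. Soundararajan, *Decay of mean values of multiplicative functions*, Canad. J. Math.
  55 (2003): Theorem 1, Lemma 2.3, Theorems 3–4, Corollary 3, Lemma 7.1, §6 (6.1). [GranvilleSoundararajan2003]
-/

noncomputable section

open Finset Filter Complex
open Literature.NumberTheory.LFunctions.GranvilleSoundararajan

namespace Literature.NumberTheory.Sieve

namespace MatomakiRadziwillL4A

set_option maxHeartbeats 1600000 in
/-- **The long-sum Lipschitz bound (eq. Lipsch of Matomäki–Radziwiłł) from Granville–Soundararajan, with
Theorem 4 for CENTRAL maximisers only.**  Identical to `lipschitz_of_GS` except that the hypothesis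
`GranvilleSoundararajan2003_theorem4_sqrtRange` (refuted for maximisers at the edge of the window, see the
docstring of that declaration) is replaced by the statement displayed as `h4`: Theorem 4 of GS03
for `x ≥ x₀`, maximisers `y₀` of `|F(1+iy)|` on `|y| ≤ 2 log x` with `|y₀| ≤ 1`, and `1 ≤ w ≤ √x` — which is
all the proof uses (Theorem 4 enters only in the case `|y₀| < 1/100`), and which follows from the statement for
central maximisers `|y₀| ≤ log x` established by §6 of the paper.
[cite: MatomakiRadziwillAnnals2016, §3, proof of Lemma 4] -/
theorem lipschitz_of_GS_central (h1 : GranvilleSoundararajan2003_theorem1) (h23 : GranvilleSoundararajan2003_lemma23)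
    (h3 : GranvilleSoundararajan2003_theorem3)
    (h4 : ∃ C x₀ : ℝ, ∀ f : ArithmeticFunction ℂ, f.IsMultiplicative → (∀ n, ‖f n‖ ≤ 1) →
      ∀ x : ℝ, x₀ ≤ x → ∀ y₀ : ℝ, |y₀| ≤ 1 →
        (∀ y : ℝ, |y| ≤ 2 * Real.log x →
          ‖truncEulerProduct f x (1 + y * I)‖ ≤ ‖truncEulerProduct f x (1 + y₀ * I)‖) →
        ∀ w : ℝ, 1 ≤ w → w ≤ Real.sqrt x →
          ‖(x : ℂ)⁻¹ * ∑ n ∈ Icc 1 ⌊x⌋₊, f n * (n : ℂ) ^ (-(y₀ * I))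
              - ((w / x : ℝ) : ℂ) * ∑ n ∈ Icc 1 ⌊x / w⌋₊, f n * (n : ℂ) ^ (-(y₀ * I))‖ ≤
            C * ((Real.log (2 * w) / Real.log x) ^ (1 - 2 / Real.pi)
                    * Real.log (Real.log x / Real.log (2 * w))
                  + Real.log (Real.log x) ^ (1 + 2 * (1 - 2 / Real.pi)) / Real.log x ^ (1 - 2 / Real.pi)))
    (hc3 : GranvilleSoundararajan2003_corollary3) (h71 : GranvilleSoundararajan2003_lemma71) :
    MatomakiRadziwill2016_lemma4_lipschitz := by
  obtain ⟨C₁, H1⟩ := h1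
  obtain ⟨C₂₃, H23⟩ := h23
  obtain ⟨C₃, H3⟩ := h3
  obtain ⟨C₄, x₄, H4⟩ := h4
  obtain ⟨Cc, xc, Hc⟩ := hc3
  obtain ⟨C₇, H7⟩ := h71
  -- constants and thresholds
  set C₂₃' := max C₂₃ 1 with hC₂₃'
  have hC₂₃'1 : 1 ≤ C₂₃' := le_max_right _ _
  have hC₂₃'le : C₂₃ ≤ C₂₃' := le_max_left _ _
  set A := 10 * Real.sqrt (50 * C₂₃') with hA
  have hA1 : 1 ≤ A := by
    have : 1 ≤ Real.sqrt (50 * C₂₃') := by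
      rw [show (1:ℝ) = Real.sqrt 1 by simp]; exact Real.sqrt_le_sqrt (by linarith)
    rw [hA]; linarith
  set ℓ₁ := max (Real.exp 27) (A ^ 4) with hℓ₁
  set B₃ := 333 * |C₃| + 43 * A + 43 * Real.exp 7 + 6 * |C₁| + 123 * |C₇| + 368 * |C₄| with hB₃
  have hB₃0 : 0 ≤ B₃ := by rw [hB₃]; positivity
  refine ⟨2 * B₃ + 96 * |Cc| + 2, max (Real.exp ℓ₁) (max x₄ xc), ?_⟩
  intro f hf hf1 X Y hX0 hYX hYX'
  have hX : Real.exp ℓ₁ ≤ X := (le_max_left _ _).trans hX0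
  have hx₄ : x₄ ≤ X := ((le_max_left _ _).trans (le_max_right _ _)).trans hX0
  have hxc : xc ≤ X := ((le_max_right _ _).trans (le_max_right _ _)).trans hX0
  /- sizes -/
  have hℓ₁27 : Real.exp 27 ≤ ℓ₁ := le_max_left _ _
  have hℓ₁A : A ^ 4 ≤ ℓ₁ := le_max_right _ _
  have hXpos : 0 < X := (Real.exp_pos _).trans_le hX
  set ℓ := Real.log X with hℓ
  have hℓge : ℓ₁ ≤ ℓ := by
    rw [hℓ, ← Real.log_exp ℓ₁]; exact Real.log_le_log (Real.exp_pos _) hX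
  have hℓ27 : 27 ≤ ℓ := by
    have := Real.add_one_le_exp (27 : ℝ); linarith
  have hℓ1 : 1 ≤ ℓ := by linarith
  have hℓ0 : 0 < ℓ := by linarith
  have hXexp : X = Real.exp ℓ := by rw [hℓ, Real.exp_log hXpos]
  have hexp1 : (27 / 10 : ℝ) ≤ Real.exp 1 := by have := Real.exp_one_gt_d9; linarith
  have hexp3 : (19 : ℝ) ≤ Real.exp 3 := by
    have : Real.exp 3 = Real.exp 1 ^ 3 := by rw [← Real.exp_nat_mul]; norm_num
    rw [this]
    calc (19 : ℝ) ≤ (27 / 10) ^ 3 := by norm_num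
      _ ≤ Real.exp 1 ^ 3 := pow_le_pow_left₀ (by norm_num) hexp1 3
  have hexp4 : (53 : ℝ) ≤ Real.exp 4 := by
    have : Real.exp 4 = Real.exp 1 ^ 4 := by rw [← Real.exp_nat_mul]; norm_num
    rw [this]
    calc (53 : ℝ) ≤ (27 / 10) ^ 4 := by norm_num
      _ ≤ Real.exp 1 ^ 4 := pow_le_pow_left₀ (by norm_num) hexp1 4
  have hX28 : 53 ≤ X := by
    have h4 : (4 : ℝ) ≤ ℓ₁ := by have := Real.add_one_le_exp (27 : ℝ); linarith
    have := Real.exp_le_exp.2 h4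
    linarith
  have hX3 : 3 ≤ X := by linarith
  have hℓ53 : 53 ≤ ℓ := by
    have := Real.exp_le_exp.2 (show (4 : ℝ) ≤ 27 by norm_num)
    linarith
  have hY0 : 0 < Y := by linarith
  have hY3 : 3 ≤ Y := by linarith
  have hlogℓ27 : 27 ≤ Real.log ℓ := by
    rw [← Real.log_exp 27]; exact Real.log_le_log (Real.exp_pos _) (hℓ₁27.trans hℓge)
  have hlogℓ1 : 1 ≤ Real.log ℓ := by linarith
  have hlogℓ0 : 0 < Real.log ℓ := by linarith
  set τq := ℓ ^ (-(1 / 4 : ℝ)) with hτq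
  have hτq0 : 0 < τq := Real.rpow_pos_of_pos hℓ0 _
  have hτq_eq : ∀ C : ℝ, C / Real.log X ^ (1 / 4 : ℝ) = C * τq := fun C => by
    rw [hτq, Real.rpow_neg hℓ0.le, div_eq_mul_inv]
  have hτq1 : 1 / ℓ ≤ τq := by
    rw [hτq, one_div, ← Real.rpow_neg_one]; exact rpow_neg_le_rpow_neg hℓ1 (by norm_num)
  /- the sums -/
  set g := toComplexAF f with hg
  have hgm : g.IsMultiplicative := isMultiplicative_toComplexAF hf
  have hg1 : ∀ n, ‖g n‖ ≤ 1 := norm_toComplexAF_le hf1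
  have hg11 : g 1 = 1 := hgm.map_one
  set SX := ∑ n ∈ Icc 1 ⌊X⌋₊, f n with hSX
  set SY := ∑ n ∈ Icc 1 ⌊Y⌋₊, f n with hSY
  set sX := X⁻¹ * SX with hsX
  set sY := Y⁻¹ * SY with hsY
  have hnSX : ‖∑ n ∈ Icc 1 ⌊X⌋₊, g n‖ = |SX| := norm_sum_toComplexAF f _
  have hnSY : ‖∑ n ∈ Icc 1 ⌊Y⌋₊, g n‖ = |SY| := norm_sum_toComplexAF f _
  have habsX : |sX| = |SX| / X := by rw [hsX, abs_mul, abs_inv, abs_of_pos hXpos]; ring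
  have habsY : |sY| = |SY| / Y := by rw [hsY, abs_mul, abs_inv, abs_of_pos hY0]; ring
  have hS1 : ∀ {Z : ℝ}, 0 ≤ Z → |∑ n ∈ Icc 1 ⌊Z⌋₊, f n| ≤ Z := fun {Z} hZ => by
    calc |∑ n ∈ Icc 1 ⌊Z⌋₊, f n| ≤ ∑ n ∈ Icc 1 ⌊Z⌋₊, |f n| := Finset.abs_sum_le_sum_abs _ _
      _ ≤ ∑ n ∈ Icc 1 ⌊Z⌋₊, (1 : ℝ) := Finset.sum_le_sum fun n _ => hf1 n
      _ = ⌊Z⌋₊ := by simp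
      _ ≤ Z := Nat.floor_le hZ
  have hsX1 : |sX| ≤ 1 := by rw [habsX, div_le_one hXpos]; exact hS1 hXpos.le
  have hsY1 : |sY| ≤ 1 := by rw [habsY, div_le_one hY0]; exact hS1 hY0.le
  rw [hτq_eq]
  change |sX - sY| ≤ (2 * B₃ + 96 * |Cc| + 2) * τq
  /- the comparison parameter `w = X/Y ∈ [1, 4]` -/
  have hw1 : 1 ≤ X / Y := (one_le_div hY0).2 hYX'
  have hw4 : X / Y ≤ 4 := by rw [div_le_iff₀ hY0]; linarith
  have hwX : X / Y ≤ Real.sqrt X := by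
    have : (4 : ℝ) ≤ Real.sqrt X := by
      rw [show (4 : ℝ) = Real.sqrt (4 ^ 2) by rw [Real.sqrt_sq (by norm_num)]]
      exact Real.sqrt_le_sqrt (by linarith)
    linarith
  have hXw : X / (X / Y) = Y := by field_simp
  have hwX' : X / Y / X = Y⁻¹ := by field_simp
  /- bounds for the `w`-terms: `(log 2w/ℓ)^α log(ℓ/log 2w) ≤ 37 τq` -/
  have hα : 9 / 25 ≤ 1 - 2 / Real.pi := by
    have hπ := Real.pi_gt_d2
    rw [le_sub_iff_add_le, show (9:ℝ)/25 + 2/Real.pi = 9/25 + 2/Real.pi from rfl]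
    have : 2 / Real.pi ≤ 16 / 25 := by rw [div_le_div_iff₀ Real.pi_pos (by norm_num)]; linarith
    linarith
  have hα' : 1 - 2 / Real.pi ≤ 1 / 2 := by
    have hπ := Real.pi_lt_four
    have : 1 / 2 ≤ 2 / Real.pi := by rw [div_le_div_iff₀ (by norm_num) Real.pi_pos]; linarith
    linarith
  have hlog2w : Real.log 2 ≤ Real.log (2 * (X / Y)) ∧ Real.log (2 * (X / Y)) ≤ 3 := by
    constructor
    · exact Real.log_le_log two_pos (by linarith)
    · calc Real.log (2 * (X / Y)) ≤ Real.log (Real.exp 3) := Real.log_le_log (by linarith) (by linarith)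
        _ = 3 := Real.log_exp 3
  have hlog2 : 1 / 2 < Real.log 2 := by have := Real.log_two_gt_d9; linarith
  have hwterm : (Real.log (2 * (X / Y)) / Real.log X) ^ (1 - 2 / Real.pi)
      * Real.log (Real.log X / Real.log (2 * (X / Y))) ≤ 37 * τq := by
    rw [← hℓ]
    obtain ⟨hl, hu⟩ := hlog2w
    have hb0 : 0 < Real.log (2 * (X / Y)) / ℓ := div_pos (by linarith) hℓ0
    have hb1 : Real.log (2 * (X / Y)) / ℓ ≤ 1 := by rw [div_le_one hℓ0]; linarith
    have h1 : (Real.log (2 * (X / Y)) / ℓ) ^ (1 - 2 / Real.pi) ≤ (3 / ℓ) ^ (9 / 25 : ℝ) :=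
      (Real.rpow_le_rpow_of_exponent_ge hb0 hb1 hα).trans
        (Real.rpow_le_rpow hb0.le (div_le_div_of_nonneg_right hu hℓ0.le) (by norm_num))
    have h2 : Real.log (ℓ / Real.log (2 * (X / Y))) ≤ 2 * Real.log ℓ := by
      have : ℓ / Real.log (2 * (X / Y)) ≤ ℓ ^ 2 := by
        rw [div_le_iff₀ (by linarith)]
        have h1 : 1 ≤ ℓ * Real.log (2 * (X / Y)) := by nlinarith only [hℓ27, hl, hlog2]
        calc ℓ = ℓ * 1 := (mul_one ℓ).symm
          _ ≤ ℓ * (ℓ * Real.log (2 * (X / Y))) := mul_le_mul_of_nonneg_left h1 hℓ0.le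
          _ = ℓ ^ 2 * Real.log (2 * (X / Y)) := by ring
      calc Real.log (ℓ / Real.log (2 * (X / Y))) ≤ Real.log (ℓ ^ 2) :=
            Real.log_le_log (div_pos hℓ0 (by linarith)) this
        _ = 2 * Real.log ℓ := by rw [Real.log_pow]; norm_num
    have h3 : (3 / ℓ) ^ (9 / 25 : ℝ) ≤ 2 * ℓ ^ (-(9 / 25 : ℝ)) := by
      rw [Real.div_rpow (by norm_num) hℓ0.le, Real.rpow_neg hℓ0.le, div_eq_mul_inv]
      refine mul_le_mul_of_nonneg_right ?_ (by positivity)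
      have h39 : ((3 : ℝ) ^ (9 / 25 : ℝ)) ^ (25 : ℕ) ≤ (2 : ℝ) ^ (25 : ℕ) := by
        rw [← Real.rpow_natCast, ← Real.rpow_mul (by norm_num)]; norm_num
      exact le_of_pow_le_pow_left₀ (by norm_num) (by norm_num) h39
    have h4 := log_mul_rpow_neg_le_quarter (a := 9 / 25) (ε := 11 / 100) hℓ1 (by norm_num) (by norm_num)
    have hlog0 : 0 ≤ Real.log (ℓ / Real.log (2 * (X / Y))) := Real.log_nonneg (by
      rw [le_div_iff₀ (by linarith)]; linarith)
    calc (Real.log (2 * (X / Y)) / ℓ) ^ (1 - 2 / Real.pi) * Real.log (ℓ / Real.log (2 * (X / Y)))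
        ≤ (2 * ℓ ^ (-(9 / 25 : ℝ))) * (2 * Real.log ℓ) :=
          mul_le_mul (h1.trans h3) h2 hlog0 (by positivity)
      _ = 4 * (Real.log ℓ * ℓ ^ (-(9 / 25 : ℝ))) := by ring
      _ ≤ 4 * ((11 / 100 : ℝ)⁻¹ * ℓ ^ (-(1 / 4 : ℝ))) := by gcongr
      _ = (4 * (11 / 100 : ℝ)⁻¹) * τq := by rw [hτq]; ring
      _ ≤ 37 * τq := mul_le_mul_of_nonneg_right (by norm_num) hτq0.le
  /- the `log log x` terms -/
  have hsqrt3 : 267 / 1000 ≤ 2 - Real.sqrt 3 := by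
    have : Real.sqrt 3 ≤ 1733 / 1000 := by
      rw [show (1733 / 1000 : ℝ) = Real.sqrt ((1733 / 1000) ^ 2) by rw [Real.sqrt_sq (by norm_num)]]
      exact Real.sqrt_le_sqrt (by norm_num)
    linarith
  have hcterm : Real.log (Real.log X) / Real.log X ^ (2 - Real.sqrt 3) ≤ 59 * τq := by
    rw [← hℓ]
    have h1 : Real.log ℓ / ℓ ^ (2 - Real.sqrt 3) ≤ Real.log ℓ * ℓ ^ (-(267 / 1000 : ℝ)) := by
      rw [div_eq_mul_inv, ← Real.rpow_neg hℓ0.le]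
      exact mul_le_mul_of_nonneg_left (rpow_neg_le_rpow_neg hℓ1 hsqrt3) hlogℓ0.le
    have h2 := log_mul_rpow_neg_le_quarter (a := 267 / 1000) (ε := 17 / 1000) hℓ1 (by norm_num) (by norm_num)
    refine h1.trans (h2.trans ?_)
    rw [← hτq]
    exact mul_le_mul_of_nonneg_right (by norm_num) hτq0.le
  have h3term : Real.log (Real.log X) ^ (1 + 2 * (1 - 2 / Real.pi)) / Real.log X ^ (1 - 2 / Real.pi) ≤ 331 * τq := by
    rw [← hℓ]
    have h1 : Real.log ℓ ^ (1 + 2 * (1 - 2 / Real.pi)) ≤ Real.log ℓ ^ 2 := by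
      have := Real.rpow_le_rpow_of_exponent_le hlogℓ1 (by linarith : 1 + 2 * (1 - 2 / Real.pi) ≤ (2 : ℝ))
      rwa [Real.rpow_two] at this
    have h2 : (Real.log ℓ ^ 2) / ℓ ^ (1 - 2 / Real.pi) ≤ Real.log ℓ ^ 2 * ℓ ^ (-(9 / 25 : ℝ)) := by
      rw [div_eq_mul_inv, ← Real.rpow_neg hℓ0.le]
      exact mul_le_mul_of_nonneg_left (rpow_neg_le_rpow_neg hℓ1 hα) (sq_nonneg _)
    have h3 := log_sq_mul_rpow_neg_le_quarter (a := 9 / 25) (ε := 55 / 1000) hℓ1 (by norm_num) (by norm_num)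
    calc Real.log ℓ ^ (1 + 2 * (1 - 2 / Real.pi)) / ℓ ^ (1 - 2 / Real.pi)
        ≤ Real.log ℓ ^ 2 / ℓ ^ (1 - 2 / Real.pi) := div_le_div_of_nonneg_right h1 (by positivity)
      _ ≤ Real.log ℓ ^ 2 * ℓ ^ (-(9 / 25 : ℝ)) := h2
      _ ≤ (55 / 1000 : ℝ)⁻¹ ^ 2 * ℓ ^ (-(1 / 4 : ℝ)) := h3
      _ ≤ 331 * τq := by
          rw [← hτq]
          exact mul_le_mul_of_nonneg_right (by norm_num) hτq0.le
  have hRterm : |C₁| * (1 / ℓ + Real.log ℓ / ℓ) ≤ 3 * |C₁| * τq := by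
    have h1 : Real.log ℓ / ℓ ≤ (4 / 3 : ℝ) * τq := by
      have := log_mul_rpow_neg_le_quarter (a := 1) (ε := 3 / 4) hℓ1 (by norm_num) (by norm_num)
      rw [Real.rpow_neg_one, ← div_eq_mul_inv] at this
      refine this.trans ?_; rw [hτq]; norm_num
    have : 1 / ℓ + Real.log ℓ / ℓ ≤ 3 * τq := by linarith
    calc |C₁| * (1 / ℓ + Real.log ℓ / ℓ) ≤ |C₁| * (3 * τq) := mul_le_mul_of_nonneg_left this (abs_nonneg _)
      _ = 3 * |C₁| * τq := by ring
  /- Step 1: Corollary 3 -/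
  have hStep1 : |(|sX| - |sY|)| ≤ 96 * |Cc| * τq := by
    have key := Hc g hgm hg1 X (X / Y) hxc hw1 hwX
    rw [hXw, hnSX, hnSY, hwX', ← habsX, show Y⁻¹ * |SY| = |sY| by rw [habsY]; ring] at key
    refine key.trans ?_
    have hpos : 0 ≤ (Real.log (2 * (X / Y)) / Real.log X) ^ (1 - 2 / Real.pi)
        * Real.log (Real.log X / Real.log (2 * (X / Y))) + Real.log (Real.log X) / Real.log X ^ (2 - Real.sqrt 3) := by
      rw [← hℓ]
      refine add_nonneg (mul_nonneg (Real.rpow_nonneg (div_nonneg (by linarith [hlog2w.1]) hℓ0.le) _)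
        (Real.log_nonneg ?_)) (by positivity)
      rw [le_div_iff₀ (by linarith [hlog2w.1])]; linarith [hlog2w.2]
    calc Cc * _ ≤ |Cc| * _ := mul_le_mul_of_nonneg_right (le_abs_self Cc) hpos
      _ ≤ |Cc| * (37 * τq + 59 * τq) := mul_le_mul_of_nonneg_left (add_le_add hwterm hcterm) (abs_nonneg _)
      _ = 96 * |Cc| * τq := by ring
  /- Step 2: equal signs -/
  by_cases hsign : 0 ≤ sX * sY
  · have : |sX - sY| = |(|sX| - |sY|)| := by
      rcases le_or_gt 0 sX with h1 | h1
      · rcases le_or_gt 0 sY with h2 | h2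
        · rw [abs_of_nonneg h1, abs_of_nonneg h2]
        · rcases h1.eq_or_lt with h3 | h3
          · rw [← h3]; simp
          · exact absurd hsign (not_le.2 (mul_neg_of_pos_of_neg h3 h2))
      · have h2 : sY ≤ 0 := by
          by_contra h2; push Not at h2
          exact absurd hsign (not_le.2 (mul_neg_of_neg_of_pos h1 h2))
        rw [abs_of_neg h1, abs_of_nonpos h2, show sX - sY = -((-sX) - (-sY)) by ring, abs_neg]
    rw [this]
    refine hStep1.trans ?_
    rw [show 96 * |Cc| * τq = (96 * |Cc|) * τq by ring]
    exact mul_le_mul_of_nonneg_right (by linarith [abs_nonneg Cc]) hτq0.le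
  push Not at hsign
  /- Step 3: opposite signs — it suffices to bound `|sX|` -/
  suffices hcase3 : |sX| ≤ B₃ * τq by
    have h1 : |sY| ≤ |sX| + 96 * |Cc| * τq := by
      have := abs_sub_abs_le_abs_sub sY sX
      rw [abs_sub_comm] at this
      linarith [le_abs_self (|sX| - |sY|), neg_abs_le (|sX| - |sY|), hStep1]
    calc |sX - sY| ≤ |sX| + |sY| := abs_sub _ _
      _ ≤ 2 * (B₃ * τq) + 96 * |Cc| * τq := by linarith
      _ = (2 * B₃ + 96 * |Cc|) * τq := by ring
      _ ≤ (2 * B₃ + 96 * |Cc| + 2) * τq := mul_le_mul_of_nonneg_right (by linarith) hτq0.le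
  /- the maximiser `y₀` and the size `Λ = |F(1+iy₀)|` -/
  obtain ⟨y₀, hy₀, hmax⟩ := exists_maximiser (g := g) hg1 X (T := ℓ) hℓ0.le
  have hy₀' : |y₀| ≤ 2 * Real.log X := by rw [← hℓ]; exact hy₀
  have hmax' : ∀ y : ℝ, |y| ≤ 2 * Real.log X →
      ‖truncEulerProduct g X (1 + y * I)‖ ≤ ‖truncEulerProduct g X (1 + y₀ * I)‖ := by
    rw [← hℓ]; exact hmax
  set Λ := ‖truncEulerProduct g X (1 + y₀ * I)‖ with hΛ
  obtain ⟨hM0, hMΛ⟩ := maxModulus_le (g := g) X hℓ0.le hmax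
  set L := maxModulus g X ℓ / ℓ with hL
  have hL0 : 0 ≤ L := div_nonneg hM0 hℓ0.le
  have hLΛ : L ≤ Λ / ℓ := div_le_div_of_nonneg_right hMΛ hℓ0.le
  -- Theorem 1 at `T = ℓ`
  have hT1 : |sX| ≤ L * (Real.log (Real.exp Real.eulerMascheroniConstant / L) + 12 / 7) + 3 * |C₁| * τq := by
    have key := H1 g hgm hg1 X ℓ hX3 hℓ1
    rw [← hℓ, hnSX, ← habsX] at key
    refine key.trans (add_le_add le_rfl ((mul_le_mul_of_nonneg_right (le_abs_self C₁) ?_).trans hRterm))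
    positivity
  -- two more rational exponent facts
  have hπlo : 4 / Real.pi ≤ 32 / 25 := by
    rw [div_le_div_iff₀ Real.pi_pos (by norm_num)]; have := Real.pi_gt_d2; linarith
  have hlogpow : Real.log ℓ ≤ 10 * ℓ ^ (1 / 10 : ℝ) := by
    have := Real.log_le_rpow_div hℓ0.le (by norm_num : (0:ℝ) < 1 / 10)
    linarith [show ℓ ^ (1 / 10 : ℝ) / (1 / 10) = 10 * ℓ ^ (1 / 10 : ℝ) by ring]
  have hpowA : A ≤ ℓ ^ (13 / 50 : ℝ) := by
    have h1 : (A ^ 4) ^ (13 / 50 : ℝ) ≤ ℓ ^ (13 / 50 : ℝ) :=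
      Real.rpow_le_rpow (by positivity) (hℓ₁A.trans hℓge) (by norm_num)
    have h2 : A ≤ (A ^ 4) ^ (13 / 50 : ℝ) := by
      rw [← Real.rpow_natCast, ← Real.rpow_mul (by linarith)]
      have := Real.rpow_le_rpow_of_exponent_le hA1 (show (1 : ℝ) ≤ (4 : ℕ) * (13 / 50) by norm_num)
      rwa [Real.rpow_one] at this
    exact h2.trans h1
  rcases le_or_gt (ℓ / 2) |y₀| with h3a | h3bc
  · /- 3a: `|y₀| ≥ ℓ/2`, Theorem 3 -/
    have key := H3 g hgm hg1 X hX3 y₀ hy₀' hmax'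
    rw [hnSX, ← habsX] at key
    have h1 : 1 / (1 + |y₀|) ≤ 2 * τq := by
      calc 1 / (1 + |y₀|) ≤ 1 / (ℓ / 2) := one_div_le_one_div_of_le (by linarith) (by linarith)
        _ = 2 * (1 / ℓ) := by field_simp
        _ ≤ 2 * τq := by linarith
    have hpos : 0 ≤ 1 / (1 + |y₀|) + Real.log (Real.log X) ^ (1 + 2 * (1 - 2 / Real.pi)) / Real.log X ^ (1 - 2 / Real.pi) := by
      rw [← hℓ]; positivity
    calc |sX| ≤ |C₃| * (1 / (1 + |y₀|) + Real.log (Real.log X) ^ (1 + 2 * (1 - 2 / Real.pi)) / Real.log X ^ (1 - 2 / Real.pi)) :=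
          key.trans (mul_le_mul_of_nonneg_right (le_abs_self _) hpos)
      _ ≤ |C₃| * (2 * τq + 331 * τq) := mul_le_mul_of_nonneg_left (add_le_add h1 h3term) (abs_nonneg _)
      _ = (333 * |C₃|) * τq := by ring
      _ ≤ B₃ * τq := mul_le_mul_of_nonneg_right (by rw [hB₃]; linarith [abs_nonneg C₁, abs_nonneg C₇, abs_nonneg C₄, (Real.exp_pos 7).le]) hτq0.le
  rcases le_or_gt (1 / 100) |y₀| with h3b | h3c
  · /- 3b: `1/100 ≤ |y₀| < ℓ/2`, Lemma 2.3 and Theorem 1 -/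
    have hβlo : 1 / Real.log X ≤ |2 * y₀| := by
      rw [← hℓ, abs_mul, abs_two]
      have : 1 / ℓ ≤ 1 / 53 := one_div_le_one_div_of_le (by norm_num) hℓ53
      linarith
    have hβhi : |2 * y₀| ≤ Real.log X := by rw [← hℓ, abs_mul, abs_two]; linarith
    have key := H23 g hgm hg1 X hX3 (-y₀) (2 * y₀) hβlo hβhi
    have e1 : ((-y₀ : ℝ) : ℂ) + ((2 * y₀ : ℝ) : ℂ) = (y₀ : ℂ) := by push_cast; ring
    have e2 := norm_truncEulerProduct_neg f X y₀
    rw [← hg] at e2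
    rw [e1, norm_mul, e2, ← hℓ] at key
    -- `Λ² ≤ C₂₃' ℓ^{32/25} · 50 (log ℓ)²`
    have hmx1 : 1 ≤ max (1 / |2 * y₀|) (Real.log ℓ ^ 2) :=
      le_max_of_le_right (by nlinarith only [hlogℓ1])
    have hmx50 : max (1 / |2 * y₀|) (Real.log ℓ ^ 2) ≤ 50 * Real.log ℓ ^ 2 := by
      refine max_le ?_ (by nlinarith only [hlogℓ1])
      rw [abs_mul, abs_two]
      calc 1 / (2 * |y₀|) ≤ 1 / (2 * (1 / 100)) := one_div_le_one_div_of_le (by norm_num) (by linarith)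
        _ = 50 := by norm_num
        _ ≤ 50 * Real.log ℓ ^ 2 := by nlinarith only [hlogℓ1]
    have hfac2 : max (1 / |2 * y₀|) (Real.log ℓ ^ 2) ^ (2 * (1 - 2 / Real.pi)) ≤ 50 * Real.log ℓ ^ 2 := by
      have := Real.rpow_le_rpow_of_exponent_le hmx1 (by linarith : 2 * (1 - 2 / Real.pi) ≤ (1 : ℝ))
      rw [Real.rpow_one] at this
      exact this.trans hmx50
    have hfac1 : ℓ ^ (4 / Real.pi) ≤ ℓ ^ (32 / 25 : ℝ) := Real.rpow_le_rpow_of_exponent_le hℓ1 hπlo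
    have hΛsq : Λ * Λ ≤ C₂₃' * ℓ ^ (32 / 25 : ℝ) * (50 * Real.log ℓ ^ 2) := by
      refine key.trans ?_
      have hnn : 0 ≤ ℓ ^ (4 / Real.pi) * max (1 / |2 * y₀|) (Real.log ℓ ^ 2) ^ (2 * (1 - 2 / Real.pi)) := by positivity
      calc C₂₃ * ℓ ^ (4 / Real.pi) * max (1 / |2 * y₀|) (Real.log ℓ ^ 2) ^ (2 * (1 - 2 / Real.pi))
          = C₂₃ * (ℓ ^ (4 / Real.pi) * max (1 / |2 * y₀|) (Real.log ℓ ^ 2) ^ (2 * (1 - 2 / Real.pi))) := by ring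
        _ ≤ C₂₃' * (ℓ ^ (32 / 25 : ℝ) * (50 * Real.log ℓ ^ 2)) :=
            mul_le_mul hC₂₃'le (mul_le_mul hfac1 hfac2 (by positivity) (by positivity)) hnn (by linarith)
        _ = _ := by ring
    -- `Λ ≤ √(50 C₂₃') ℓ^{16/25} log ℓ` and `L ≤ Lb := √(50C₂₃') ℓ^{-9/25} log ℓ`
    set R := Real.sqrt (50 * C₂₃') with hR
    have hR0 : 0 ≤ R := Real.sqrt_nonneg _
    have hRsq : R * R = 50 * C₂₃' := Real.mul_self_sqrt (by linarith)
    have hAR : A = 10 * R := by rw [hA, hR]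
    have hΛle : Λ ≤ R * ℓ ^ (16 / 25 : ℝ) * Real.log ℓ := by
      have hsq : Λ * Λ ≤ (R * ℓ ^ (16 / 25 : ℝ) * Real.log ℓ) * (R * ℓ ^ (16 / 25 : ℝ) * Real.log ℓ) := by
        have e : (R * ℓ ^ (16 / 25 : ℝ) * Real.log ℓ) * (R * ℓ ^ (16 / 25 : ℝ) * Real.log ℓ)
            = (R * R) * (ℓ ^ (16 / 25 : ℝ) * ℓ ^ (16 / 25 : ℝ)) * Real.log ℓ ^ 2 := by ring
        rw [e, hRsq, ← Real.rpow_add hℓ0]; norm_num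
        linarith [hΛsq]
      exact (mul_self_le_mul_self_iff (norm_nonneg _) (by positivity)).2 hsq
    set Lb := A * ℓ ^ (-(13 / 50 : ℝ)) with hLbdef
    have hLb : L ≤ Lb := by
      refine hLΛ.trans ?_
      rw [div_le_iff₀ hℓ0]
      have e3 : R * ℓ ^ (16 / 25 : ℝ) * (10 * ℓ ^ (1 / 10 : ℝ)) = A * ℓ ^ (37 / 50 : ℝ) := by
        rw [hAR, show (37 / 50 : ℝ) = 16 / 25 + 1 / 10 by norm_num, Real.rpow_add hℓ0]; ring
      have e4 : Lb * ℓ = A * ℓ ^ (37 / 50 : ℝ) := by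
        rw [hLbdef, show (37 / 50 : ℝ) = -(13 / 50) + 1 by norm_num, Real.rpow_add hℓ0, Real.rpow_one]; ring
      calc Λ ≤ R * ℓ ^ (16 / 25 : ℝ) * Real.log ℓ := hΛle
        _ ≤ R * ℓ ^ (16 / 25 : ℝ) * (10 * ℓ ^ (1 / 10 : ℝ)) := mul_le_mul_of_nonneg_left hlogpow (by positivity)
        _ = A * ℓ ^ (37 / 50 : ℝ) := e3
        _ = Lb * ℓ := e4.symm
    have hLb1 : Lb ≤ 1 := by
      rw [hLbdef, Real.rpow_neg hℓ0.le, ← div_eq_mul_inv, div_le_one (by positivity)]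
      exact hpowA
    have hmain := thm1_with_bound hT1 hL0 hLb hLb1
    have hLbpow : Lb ^ (39 / 40 : ℝ) ≤ A * τq := by
      rw [hLbdef, Real.mul_rpow (by linarith) (Real.rpow_nonneg hℓ0.le _), ← Real.rpow_mul hℓ0.le]
      refine mul_le_mul ?_ ?_ (by positivity) (by linarith)
      · have := Real.rpow_le_rpow_of_exponent_le hA1 (show (39 / 40 : ℝ) ≤ 1 by norm_num)
        rwa [Real.rpow_one] at this
      · rw [hτq]; norm_num; exact rpow_neg_le_rpow_neg hℓ1 (by norm_num)
    calc |sX| ≤ 43 * Lb ^ (39 / 40 : ℝ) + 3 * |C₁| * τq := hmain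
      _ ≤ 43 * (A * τq) + 3 * |C₁| * τq := by linarith [mul_le_mul_of_nonneg_left hLbpow (by norm_num : (0:ℝ) ≤ 43)]
      _ = (43 * A + 3 * |C₁|) * τq := by ring
      _ ≤ B₃ * τq := mul_le_mul_of_nonneg_right (by rw [hB₃]; linarith [abs_nonneg C₃, abs_nonneg C₁, abs_nonneg C₇, abs_nonneg C₄, (Real.exp_pos 7).le]) hτq0.le
  /- 3c: `|y₀| < 1/100` -/
  set M₀ := Msum g X y₀ with hM₀
  rcases le_or_gt (27 / 100 * Real.log ℓ) M₀ with hi | hii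
  · /- 3c-i: large pretentious sum: `Λ ≤ e⁷ ℓ e^{-M₀} ≤ e⁷ ℓ^{1 - 27/100}`, Theorem 1 -/
    have hΛ1 : Λ ≤ Real.exp 7 * ℓ * Real.exp (-M₀) := by
      have := norm_truncEulerProduct_le (g := g) hg1 hg11 (x := X) (by linarith) y₀
      rwa [← hℓ] at this
    have hexpM : Real.exp (-M₀) ≤ ℓ ^ (-(27 / 100 : ℝ)) := by
      rw [Real.rpow_def_of_pos hℓ0]
      exact Real.exp_le_exp.2 (by linarith)
    set Lb := Real.exp 7 * ℓ ^ (-(27 / 100 : ℝ)) with hLbdef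
    have hLb : L ≤ Lb := by
      refine hLΛ.trans ?_
      rw [div_le_iff₀ hℓ0]
      calc Λ ≤ Real.exp 7 * ℓ * Real.exp (-M₀) := hΛ1
        _ ≤ Real.exp 7 * ℓ * ℓ ^ (-(27 / 100 : ℝ)) := mul_le_mul_of_nonneg_left hexpM (by positivity)
        _ = Lb * ℓ := by rw [hLbdef]; ring
    have hLb1 : Lb ≤ 1 := by
      -- `e⁷ ≤ ℓ^{27/100}` since `ℓ ≥ e^{27}`
      have h1 : Real.exp 27 ^ (27 / 100 : ℝ) ≤ ℓ ^ (27 / 100 : ℝ) :=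
        Real.rpow_le_rpow (Real.exp_pos _).le (hℓ₁27.trans hℓge) (by norm_num)
      rw [← Real.exp_mul] at h1
      have h2 : Real.exp 7 ≤ Real.exp (27 * (27 / 100)) := Real.exp_le_exp.2 (by norm_num)
      rw [hLbdef, Real.rpow_neg hℓ0.le, ← div_eq_mul_inv, div_le_one (by positivity)]
      exact h2.trans h1
    have hmain := thm1_with_bound hT1 hL0 hLb hLb1
    have hLbpow : Lb ^ (39 / 40 : ℝ) ≤ Real.exp 7 * τq := by
      rw [hLbdef, Real.mul_rpow (Real.exp_pos _).le (Real.rpow_nonneg hℓ0.le _), ← Real.rpow_mul hℓ0.le]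
      refine mul_le_mul ?_ ?_ (by positivity) (Real.exp_pos _).le
      · have h1 : (1 : ℝ) ≤ Real.exp 7 := by have := Real.add_one_le_exp (7:ℝ); linarith
        have := Real.rpow_le_rpow_of_exponent_le h1 (show (39 / 40 : ℝ) ≤ 1 by norm_num)
        rwa [Real.rpow_one] at this
      · rw [hτq]; norm_num; exact rpow_neg_le_rpow_neg hℓ1 (by norm_num)
    calc |sX| ≤ 43 * Lb ^ (39 / 40 : ℝ) + 3 * |C₁| * τq := hmain
      _ ≤ 43 * (Real.exp 7 * τq) + 3 * |C₁| * τq := by linarith [mul_le_mul_of_nonneg_left hLbpow (by norm_num : (0:ℝ) ≤ 43)]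
      _ = (43 * Real.exp 7 + 3 * |C₁|) * τq := by ring
      _ ≤ B₃ * τq := mul_le_mul_of_nonneg_right (by rw [hB₃]; linarith [abs_nonneg C₃, abs_nonneg C₁, abs_nonneg C₇, abs_nonneg C₄, (Real.exp_pos 7).le, hA1]) hτq0.le
  /- 3c-ii: small pretentious sum: Lemma 7.1, Theorem 4 and the sign argument -/
  set g₀ := twistAF g y₀ with hg₀
  have hg₀m : g₀.IsMultiplicative := isMultiplicative_twistAF hgm y₀
  have hg₀1 : ∀ n, ‖g₀ n‖ ≤ 1 := norm_twistAF_le hg1 y₀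
  -- (7.4): the prime sum of `|1 - g₀(p)|/p`
  have hMert : ∑ p ∈ Nat.primesBelow (⌊X⌋₊ + 1), (1 : ℝ) / p ≤ Real.log ℓ + 4 := by
    have hN : 2 ≤ ⌊X⌋₊ := Nat.le_floor (by norm_num; linarith)
    refine (Literature.NumberTheory.LFunctions.MertensBound.sum_inv_prime_le ⌊X⌋₊ hN).trans ?_
    have hfl : (⌊X⌋₊ : ℝ) ≤ X := Nat.floor_le hXpos.le
    have hfl2 : (2 : ℝ) ≤ ⌊X⌋₊ := by exact_mod_cast hN
    have := Real.log_le_log (Real.log_pos (by linarith)) (Real.log_le_log (by linarith) hfl)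
    rw [← hℓ] at this; linarith
  have hSg : ∑ p ∈ Nat.primesBelow (⌊X⌋₊ + 1), ‖1 - g₀ p‖ / p ≤ 735 / 1000 * Real.log ℓ + 3 := by
    have hcs := sq_sum_norm_one_sub_le hg1 X y₀
    rw [← hM₀] at hcs
    set Sg1 := ∑ p ∈ Nat.primesBelow (⌊X⌋₊ + 1), ‖1 - g p * (p : ℂ) ^ (-(y₀ * I))‖ / p with hSg1
    have hSgeq : ∑ p ∈ Nat.primesBelow (⌊X⌋₊ + 1), ‖1 - g₀ p‖ / p = Sg1 := by
      rw [hSg1]; rfl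
    rw [hSgeq]
    have hSg0 : 0 ≤ Sg1 := Finset.sum_nonneg fun p _ => by positivity
    have hM₀0 : 0 ≤ M₀ := by
      rw [hM₀, Msum]
      refine Finset.sum_nonneg fun p hp => div_nonneg ?_ (Nat.cast_nonneg _)
      have h := norm_natCast_cpow_mul_I p (-y₀)
      rw [show ((-y₀ : ℝ) : ℂ) * I = -(y₀ * I) by push_cast; ring] at h
      have : (g p * (p : ℂ) ^ (-(y₀ * I))).re ≤ ‖g p * (p : ℂ) ^ (-(y₀ * I))‖ := Complex.re_le_norm _
      have : ‖g p * (p : ℂ) ^ (-(y₀ * I))‖ ≤ 1 := by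
        rw [norm_mul]; exact mul_le_one₀ (hg1 p) (norm_nonneg _) h
      linarith
    have hsq : Sg1 * Sg1 ≤ (735 / 1000 * (Real.log ℓ + 4)) * (735 / 1000 * (Real.log ℓ + 4)) := by
      calc Sg1 * Sg1 = Sg1 ^ 2 := (sq Sg1).symm
        _ ≤ 2 * (∑ p ∈ Nat.primesBelow (⌊X⌋₊ + 1), (1 : ℝ) / p) * M₀ := hcs
        _ ≤ 2 * (Real.log ℓ + 4) * (27 / 100 * Real.log ℓ) :=
            mul_le_mul (mul_le_mul_of_nonneg_left hMert zero_le_two) hii.le hM₀0 (by positivity)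
        _ ≤ (735 / 1000 * (Real.log ℓ + 4)) * (735 / 1000 * (Real.log ℓ + 4)) := by
            nlinarith only [hlogℓ1]
    have := (mul_self_le_mul_self_iff hSg0 (by positivity)).2 hsq
    linarith
  -- the common error bound from Lemma 7.1 at `Z ∈ {X, Y}`
  set u : ℂ := 1 + (y₀ : ℂ) * I with hu
  have hu1 : 1 ≤ ‖u‖ := one_le_norm_one_add_mul_I y₀
  have hu2 : ‖u‖ ≤ 101 / 100 := (norm_one_add_mul_I_le y₀).trans (by linarith [h3c.le])
  have hu0 : u ≠ 0 := by intro h; rw [h, norm_zero] at hu1; exact absurd hu1 (by norm_num)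
  have he3 : Real.exp 3 ≤ 201 / 10 := by
    have h1 : Real.exp 3 = Real.exp 1 ^ 3 := by rw [← Real.exp_nat_mul]; norm_num
    have h2 : Real.exp 1 ≤ 2.7182818286 := Real.exp_one_lt_d9.le
    rw [h1]
    calc Real.exp 1 ^ 3 ≤ (2.7182818286 : ℝ) ^ 3 := pow_le_pow_left₀ (Real.exp_pos 1).le h2 3
      _ ≤ 201 / 10 := by norm_num
  have hlogey : Real.log (Real.exp 1 + |y₀|) ≤ 101 / 100 := by
    have h1 : Real.log (Real.exp 1 + |y₀|) = 1 + Real.log (1 + |y₀| / Real.exp 1) := by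
      rw [show Real.exp 1 + |y₀| = Real.exp 1 * (1 + |y₀| / Real.exp 1) by field_simp,
        Real.log_mul (Real.exp_pos 1).ne' (by positivity), Real.log_exp]
    have h2 := Real.log_le_sub_one_of_pos (show 0 < 1 + |y₀| / Real.exp 1 by positivity)
    have h3 : |y₀| / Real.exp 1 ≤ |y₀| := div_le_self (abs_nonneg _) (by linarith [hexp1])
    linarith [h3c.le]
  have hE : ∀ {Z : ℝ}, 3 ≤ Z → Z ≤ X → X / 4 ≤ Z →
      ‖((Z⁻¹ * ∑ n ∈ Icc 1 ⌊Z⌋₊, f n : ℝ) : ℂ)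
          - (Z : ℂ) ^ ((y₀ : ℂ) * I) * u⁻¹ * ((Z : ℂ)⁻¹ * ∑ n ∈ Icc 1 ⌊Z⌋₊, g₀ n)‖ ≤ 41 * |C₇| * τq := by
    intro Z hZ3 hZX hZ4
    have hZ0 : 0 < Z := by linarith
    have key := H7 g₀ hg₀m hg₀1 Z hZ3 y₀
    rw [hg₀, sum_twistAF_mul_cpow g y₀, ← hg₀, hg, sum_toComplexAF f] at key
    -- the error term of Lemma 7.1
    have hexpSg : Real.exp (∑ p ∈ Nat.primesBelow (⌊Z⌋₊ + 1), ‖1 - g₀ p‖ / p) ≤ Real.exp 3 * ℓ ^ (735 / 1000 : ℝ) := by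
      have h1 : ∑ p ∈ Nat.primesBelow (⌊Z⌋₊ + 1), ‖1 - g₀ p‖ / p ≤ ∑ p ∈ Nat.primesBelow (⌊X⌋₊ + 1), ‖1 - g₀ p‖ / p :=
        Finset.sum_le_sum_of_subset_of_nonneg (primesBelow_mono hZX) fun p _ _ => by positivity
      calc Real.exp (∑ p ∈ Nat.primesBelow (⌊Z⌋₊ + 1), ‖1 - g₀ p‖ / p)
          ≤ Real.exp (735 / 1000 * Real.log ℓ + 3) := Real.exp_le_exp.2 (h1.trans hSg)
        _ = Real.exp 3 * ℓ ^ (735 / 1000 : ℝ) := by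
            rw [Real.exp_add, Real.rpow_def_of_pos hℓ0]; ring_nf
    have hlogZ : ℓ / 2 ≤ Real.log Z := by
      have h1 : Real.log (X / 4) ≤ Real.log Z := Real.log_le_log (by positivity) hZ4
      rw [Real.log_div hXpos.ne' (by norm_num), ← hℓ] at h1
      have h2 : Real.log 4 ≤ ℓ / 2 := by
        have : Real.log 4 ≤ Real.log (Real.exp 3) := Real.log_le_log (by norm_num) (by linarith)
        rw [Real.log_exp] at this; linarith
      linarith
    have hlogZ0 : 0 < Real.log Z := by linarith
    have hbound : C₇ * (Z / Real.log Z) * Real.log (Real.exp 1 + |y₀|)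
        * Real.exp (∑ p ∈ Nat.primesBelow (⌊Z⌋₊ + 1), ‖1 - g₀ p‖ / p) ≤ Z * (41 * |C₇| * τq) := by
      have hZl : Z / Real.log Z ≤ 2 * Z / ℓ := by
        rw [div_le_div_iff₀ hlogZ0 hℓ0]; nlinarith only [hlogZ, hZ0]
      have hpow : ℓ ^ (735 / 1000 : ℝ) / ℓ = ℓ ^ (-(265 / 1000 : ℝ)) := by
        rw [div_eq_iff hℓ0.ne', ← Real.rpow_add_one hℓ0.ne']; norm_num
      have hτ : ℓ ^ (-(265 / 1000 : ℝ)) ≤ τq := by rw [hτq]; exact rpow_neg_le_rpow_neg hℓ1 (by norm_num)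
      calc C₇ * (Z / Real.log Z) * Real.log (Real.exp 1 + |y₀|) * Real.exp (∑ p ∈ Nat.primesBelow (⌊Z⌋₊ + 1), ‖1 - g₀ p‖ / p)
          ≤ |C₇| * (2 * Z / ℓ) * (101 / 100) * (Real.exp 3 * ℓ ^ (735 / 1000 : ℝ)) := by
            have a1 : C₇ * (Z / Real.log Z) * Real.log (Real.exp 1 + |y₀|)
                ≤ |C₇| * (2 * Z / ℓ) * (101 / 100) :=
              calc C₇ * (Z / Real.log Z) * Real.log (Real.exp 1 + |y₀|)
                  ≤ |C₇ * (Z / Real.log Z) * Real.log (Real.exp 1 + |y₀|)| := le_abs_self _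
                _ = |C₇| * (Z / Real.log Z) * Real.log (Real.exp 1 + |y₀|) := by
                    rw [abs_mul, abs_mul, abs_of_pos (div_pos hZ0 hlogZ0),
                      abs_of_nonneg (Real.log_nonneg (by linarith [hexp1, abs_nonneg y₀]))]
                _ ≤ |C₇| * (2 * Z / ℓ) * (101 / 100) :=
                    mul_le_mul (mul_le_mul_of_nonneg_left hZl (abs_nonneg _)) hlogey
                      (Real.log_nonneg (by linarith [hexp1, abs_nonneg y₀])) (by positivity)
            exact mul_le_mul a1 hexpSg (Real.exp_pos _).le (by positivity)
        _ = Z * ((202 / 100 * Real.exp 3) * |C₇| * (ℓ ^ (735 / 1000 : ℝ) / ℓ)) := by ring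
        _ ≤ Z * (41 * |C₇| * τq) := by
            refine mul_le_mul_of_nonneg_left ?_ hZ0.le
            rw [hpow]
            refine mul_le_mul (mul_le_mul_of_nonneg_right (by linarith) (abs_nonneg _)) hτ
              (Real.rpow_nonneg hℓ0.le _) (by positivity)
    -- divide by `Z`
    have hsc : ((Z⁻¹ * ∑ n ∈ Icc 1 ⌊Z⌋₊, f n : ℝ) : ℂ)
        - (Z : ℂ) ^ ((y₀ : ℂ) * I) * u⁻¹ * ((Z : ℂ)⁻¹ * ∑ n ∈ Icc 1 ⌊Z⌋₊, g₀ n)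
        = (Z : ℂ)⁻¹ * (((∑ n ∈ Icc 1 ⌊Z⌋₊, f n : ℝ) : ℂ)
            - (Z : ℂ) ^ ((y₀ : ℂ) * I) / (1 + (y₀ : ℂ) * I) * ∑ n ∈ Icc 1 ⌊Z⌋₊, g₀ n) := by
      rw [hu]; push_cast; field_simp
    rw [hsc, norm_mul, norm_inv, Complex.norm_real, Real.norm_eq_abs, abs_of_pos hZ0,
      inv_mul_le_iff₀ hZ0]
    exact key.trans hbound
  -- Theorem 4: the twisted averages at `X` and `Y` are close
  have hbXY : ‖(X : ℂ)⁻¹ * ∑ n ∈ Icc 1 ⌊X⌋₊, g₀ n - (Y : ℂ)⁻¹ * ∑ n ∈ Icc 1 ⌊Y⌋₊, g₀ n‖ ≤ 368 * |C₄| * τq := by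
    have key := H4 g hgm hg1 X hx₄ y₀ (by linarith [h3c.le]) hmax' (X / Y) hw1 hwX
    rw [hXw, hwX'] at key
    have e1 : ∀ N : ℕ, ∑ n ∈ Icc 1 N, g n * (n : ℂ) ^ (-((y₀ : ℂ) * I)) = ∑ n ∈ Icc 1 N, g₀ n := fun N => rfl
    rw [e1, e1, show (((Y⁻¹ : ℝ)) : ℂ) = (Y : ℂ)⁻¹ by push_cast; rfl] at key
    refine key.trans ?_
    have hpos : 0 ≤ (Real.log (2 * (X / Y)) / Real.log X) ^ (1 - 2 / Real.pi)
        * Real.log (Real.log X / Real.log (2 * (X / Y)))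
        + Real.log (Real.log X) ^ (1 + 2 * (1 - 2 / Real.pi)) / Real.log X ^ (1 - 2 / Real.pi) := by
      rw [← hℓ]
      refine add_nonneg (mul_nonneg (Real.rpow_nonneg (div_nonneg (by linarith [hlog2w.1]) hℓ0.le) _)
        (Real.log_nonneg ?_)) (by positivity)
      rw [le_div_iff₀ (by linarith [hlog2w.1])]; linarith [hlog2w.2]
    calc C₄ * _ ≤ |C₄| * _ := mul_le_mul_of_nonneg_right (le_abs_self C₄) hpos
      _ ≤ |C₄| * (37 * τq + 331 * τq) := mul_le_mul_of_nonneg_left (add_le_add hwterm h3term) (abs_nonneg _)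
      _ = 368 * |C₄| * τq := by ring
  -- the sign argument
  have hPXY : ‖(X : ℂ) ^ ((y₀ : ℂ) * I) - (Y : ℂ) ^ ((y₀ : ℂ) * I)‖ ≤ 142 / 10000 := by
    refine (norm_cpow_sub_cpow_le hY0 hYX' y₀).trans ?_
    have h4 : Real.log (X / Y) ≤ 142 / 100 := by
      calc Real.log (X / Y) ≤ Real.log 4 := Real.log_le_log (by positivity) hw4
        _ = 2 * Real.log 2 := by rw [show (4:ℝ) = 2 ^ 2 by norm_num, Real.log_pow]; norm_num
        _ ≤ 142 / 100 := by have := Real.log_two_lt_d9; linarith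
    calc |y₀| * Real.log (X / Y) ≤ (1 / 100) * (142 / 100) :=
          mul_le_mul h3c.le h4 (Real.log_nonneg hw1) (by norm_num)
      _ = 142 / 10000 := by norm_num
  have hEX := hE hX3 le_rfl (by linarith)
  have hEY := hE hY3 hYX' hYX
  have hfin := sign_trick (sX := sX) (sY := sY) hu2 hu1 (norm_ofReal_cpow_mul_I hXpos y₀) (norm_ofReal_cpow_mul_I hY0 y₀)
    hPXY (by positivity) hEX hEY hbXY hsign
  calc |sX| ≤ 3 * (41 * |C₇| * τq) + 368 * |C₄| * τq := hfin
    _ = (123 * |C₇| + 368 * |C₄|) * τq := by ring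
    _ ≤ B₃ * τq := mul_le_mul_of_nonneg_right (by rw [hB₃]; linarith [abs_nonneg C₃, abs_nonneg C₁, abs_nonneg C₇, abs_nonneg C₄, (Real.exp_pos 7).le, hA1]) hτq0.le


/-! ### Fed by the corrected named fact `GranvilleSoundararajan2003_theorem4_central` -/

/-- The corrected Theorem 4 of GS03 for central maximisers (`GranvilleSoundararajan2003_theorem4_central`:
`x ≥ x₀`, `|y₀| ≤ log x`, `1 ≤ w ≤ √x`) implies the hypothesis displayed in `lipschitz_of_GS_central`
(maximisers with `|y₀| ≤ 1`): enlarge the threshold to `max x₀ e`, so that `|y₀| ≤ 1 ≤ log x`.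
[cite: GranvilleSoundararajan2003, Theorem 4 and §6 (6.1)] -/
theorem theorem4_displayed_of_central (h4 : GranvilleSoundararajan2003_theorem4_central) :
    ∃ C x₀ : ℝ, ∀ f : ArithmeticFunction ℂ, f.IsMultiplicative → (∀ n, ‖f n‖ ≤ 1) →
      ∀ x : ℝ, x₀ ≤ x → ∀ y₀ : ℝ, |y₀| ≤ 1 →
        (∀ y : ℝ, |y| ≤ 2 * Real.log x →
          ‖truncEulerProduct f x (1 + y * I)‖ ≤ ‖truncEulerProduct f x (1 + y₀ * I)‖) →
        ∀ w : ℝ, 1 ≤ w → w ≤ Real.sqrt x →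
          ‖(x : ℂ)⁻¹ * ∑ n ∈ Icc 1 ⌊x⌋₊, f n * (n : ℂ) ^ (-(y₀ * I))
              - ((w / x : ℝ) : ℂ) * ∑ n ∈ Icc 1 ⌊x / w⌋₊, f n * (n : ℂ) ^ (-(y₀ * I))‖ ≤
            C * ((Real.log (2 * w) / Real.log x) ^ (1 - 2 / Real.pi)
                    * Real.log (Real.log x / Real.log (2 * w))
                  + Real.log (Real.log x) ^ (1 + 2 * (1 - 2 / Real.pi)) / Real.log x ^ (1 - 2 / Real.pi)) := by
  obtain ⟨C, x₀, H⟩ := h4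
  refine ⟨C, max x₀ (Real.exp 1), fun f hf hf1 x hx y₀ hy₀ hmax w hw1 hwx =>
    H f hf hf1 x ((le_max_left _ _).trans hx) y₀ ?_ hmax w hw1 hwx⟩
  have h1 : 1 ≤ Real.log x := by
    rw [← Real.log_exp 1]
    exact Real.log_le_log (Real.exp_pos 1) ((le_max_right _ _).trans hx)
  linarith

/-- **The long-sum Lipschitz bound (eq. Lipsch of Matomäki–Radziwiłł) from the Granville–Soundararajan facts,
with the corrected Theorem 4** (`GranvilleSoundararajan2003_theorem4_central`, central maximisers) as the
fourth input: `theorem1 → lemma23 → theorem3 → theorem4_central → corollary3 → lemma71 → lemma4_lipschitz`.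
This is the entry point to use in place of `lipschitz_of_GS`. [cite: MatomakiRadziwillAnnals2016, §3, proof of Lemma 4] -/
theorem lipschitz_of_GS_of_theorem4_central (h1 : GranvilleSoundararajan2003_theorem1)
    (h23 : GranvilleSoundararajan2003_lemma23) (h3 : GranvilleSoundararajan2003_theorem3)
    (h4 : GranvilleSoundararajan2003_theorem4_central) (hc3 : GranvilleSoundararajan2003_corollary3)
    (h71 : GranvilleSoundararajan2003_lemma71) : MatomakiRadziwill2016_lemma4_lipschitz :=
  lipschitz_of_GS_central h1 h23 h3 (theorem4_displayed_of_central h4) hc3 h71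

end MatomakiRadziwillL4A

/-- **Lemma 4 of Matomäki–Radziwiłł from the Granville–Soundararajan facts, with the corrected Theorem 4**
(paper-facing name; use in place of `MatomakiRadziwill2016_lemma4_of_GS`): composition of
`MatomakiRadziwillL4A.lipschitz_of_GS_of_theorem4_central` with `MatomakiRadziwill2016_lemma4_of_lipschitz`.
[cite: MatomakiRadziwillAnnals2016, §3, Lemma 4] -/
theorem MatomakiRadziwill2016_lemma4_of_GS_central
    (h1 : Literature.NumberTheory.LFunctions.GranvilleSoundararajan.GranvilleSoundararajan2003_theorem1)
    (h23 : Literature.NumberTheory.LFunctions.GranvilleSoundararajan.GranvilleSoundararajan2003_lemma23)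
    (h3 : Literature.NumberTheory.LFunctions.GranvilleSoundararajan.GranvilleSoundararajan2003_theorem3)
    (h4 : Literature.NumberTheory.LFunctions.GranvilleSoundararajan.GranvilleSoundararajan2003_theorem4_central)
    (hc3 : Literature.NumberTheory.LFunctions.GranvilleSoundararajan.GranvilleSoundararajan2003_corollary3)
    (h71 : Literature.NumberTheory.LFunctions.GranvilleSoundararajan.GranvilleSoundararajan2003_lemma71) :
    MatomakiRadziwill2016_lemma4 :=
  MatomakiRadziwill2016_lemma4_of_lipschitz
    (MatomakiRadziwillL4A.lipschitz_of_GS_of_theorem4_central h1 h23 h3 h4 hc3 h71)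

end Literature.NumberTheory.Sieve
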